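import Summits.Parity.BatemanHorn.Theorems.PolyMobiusTail.Negative.Equivalence
import Summits.Parity.BatemanHorn.Theorems.PolyMobiusTail.Negative.Structure

/-!
# Crux `PolyMobiusTail` (stmt-Parity-0870), line `Sketch`: the held stub `stub_naturalLogTail` is crux-sized

Lead prover `prover-line-stmt-Parity-0870-0`.  Modulo the theorem-grade glue of the line — bridge 1
(`Σ_{n≤x} ((-1)^k routeTail − naturalTail)(n, x^{1-η}) = o(x)`, proved for `k = 1`) and the strip
(`Σ_{n≤x} (naturalTail(n, x^{1-η}) − naturalTail(n, x/(log x)^{2k+2})) = o(x)`, proved for `k = 1` modulo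
Landau's M-form), both taken here as HYPOTHESES for all `k`, and modulo the theorem-grade support
`TypeIMainTerm` (stmt-Parity-0873, hypothesis) — the natural log-tail statement `NaturalLogTail`
(stub 5 of the skeleton) is EQUIVALENT to the crux `PolyMobiusTail`.  So stub 5 carries exactly the
parity content of the crux (= `Λ`-Bateman–Horn for every system, `Negative/Equivalence.lean`): it is
crux-sized, not a lemma.

* `naturalLogTail_fin_zero` — the empty system: the natural log tail is eventually `0`.
* `naturalLogTail_iff_polyMobiusTail` — the equivalence.
-/

namespace Summit.Parity.BatemanHorn.Theorems.PolyMobiusTail.NaturalForm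

open scoped BigOperators
open Filter Asymptotics Polynomial ArithmeticFunction
open Literature.NumberTheory.Sieve
open Summit.Parity.BatemanHorn.Theses.IsogenyRedei (PolyMobiusTail TypeIMainTerm)
open Summit.Parity.BatemanHorn.Theorems.PolyMobiusTail.Negative
  (polyMobiusTail_iff_forall_eta polyMobiusTail_fin_zero)

/-- The natural log tail of the EMPTY system (`k = 0`) is eventually `0`: the only divisor tuple is the
empty one (`∏ = 1`) and `x/(log x)^2 ≥ 1` for all large `x`. [folklore] -/
theorem naturalLogTail_fin_zero (f : Fin 0 → ℤ[X]) :
    (fun x : ℕ => ∑ n ∈ Finset.Icc 1 x,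
      ∑ d ∈ Fintype.piFinset (fun i => (((f i).eval (n : ℤ)).toNat).divisors),
        if (x : ℝ) / Real.log x ^ (2 * 0 + 2) < ∏ i, (d i : ℝ) then
          ∏ i, ((moebius (d i) : ℝ) * Real.log ((((f i).eval (n : ℤ)).toNat : ℝ) / (d i : ℝ))) else 0)
      =o[atTop] fun x : ℕ => (x : ℝ) := by
  have hlog : ∀ᶠ x : ℝ in atTop, Real.log x ^ 2 ≤ 1 / 2 * x := by
    have h := (Real.isLittleO_pow_log_id_atTop (n := 2)).bound (by norm_num : (0 : ℝ) < 1 / 2)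
    filter_upwards [h, eventually_ge_atTop (1 : ℝ)] with x hx hx1
    simp only [id_eq, Real.norm_eq_abs, abs_of_nonneg (by positivity : (0 : ℝ) ≤ Real.log x ^ 2),
      abs_of_nonneg (by linarith : (0 : ℝ) ≤ x)] at hx
    exact hx
  refine (isLittleO_zero (fun x : ℕ => (x : ℝ)) atTop).congr' ?_ EventuallyEq.rfl
  filter_upwards [tendsto_natCast_atTop_atTop.eventually hlog,
    eventually_ge_atTop (3 : ℕ)] with x hx hx3
  symm
  refine Finset.sum_eq_zero fun n _ => Finset.sum_eq_zero fun d _ => ?_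
  rw [if_neg]
  simp only [Finset.univ_eq_empty, Finset.prod_empty, not_lt, mul_zero, zero_add]
  have hx1 : (1 : ℝ) < x := by exact_mod_cast (by omega : 1 < x)
  have hlogpos : 0 < Real.log x := Real.log_pos hx1
  rw [one_le_div (by positivity)]
  nlinarith

/-- **Stub 5 is crux-sized.** Modulo `TypeIMainTerm` and the two theorem-grade bridges of the line
(hypotheses `hBridge`, `hStrip`, stated for all `k`; proved in the tree for `k = 1`), the natural
log-tail statement for every Bateman–Horn system is EQUIVALENT to the crux `PolyMobiusTail`.
(`→`: `η = 3/4` and `(-1)^k·((-1)^k R − A) + (A − B) + B = R` pointwise; `←`: the crux holds at EVERY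
`η ∈ (0,1)` by `polyMobiusTail_iff_forall_eta`, take `η = 3/4` and subtract the two bridges.) [folklore] -/
theorem naturalLogTail_iff_polyMobiusTail (hMain : TypeIMainTerm)
    (hBridge : ∀ (k : ℕ) (f : Fin k → ℤ[X]), IsBatemanHornSystem f → ∀ η : ℝ, 1 / 2 < η → η < 1 →
      (fun x : ℕ => ∑ n ∈ Finset.Icc 1 x,
        ((-1 : ℝ) ^ k * (∑ d ∈ Fintype.piFinset (fun i => (((f i).eval (n : ℤ)).toNat).divisors),
            if (x : ℝ) ^ (1 - η) < ∏ i, (d i : ℝ) then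
              ∏ i, ((moebius (d i) : ℝ) * Real.log (d i)) else 0)
          - (∑ d ∈ Fintype.piFinset (fun i => (((f i).eval (n : ℤ)).toNat).divisors),
            if (x : ℝ) ^ (1 - η) < ∏ i, (d i : ℝ) then
              ∏ i, ((moebius (d i) : ℝ) *
                Real.log ((((f i).eval (n : ℤ)).toNat : ℝ) / (d i : ℝ))) else 0)))
        =o[atTop] fun x : ℕ => (x : ℝ))
    (hStrip : ∀ (k : ℕ), 1 ≤ k → ∀ (f : Fin k → ℤ[X]), IsBatemanHornSystem f →
      ∀ η : ℝ, 1 / 2 < η → η < 1 →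
      (fun x : ℕ => ∑ n ∈ Finset.Icc 1 x,
        ((∑ d ∈ Fintype.piFinset (fun i => (((f i).eval (n : ℤ)).toNat).divisors),
            if (x : ℝ) ^ (1 - η) < ∏ i, (d i : ℝ) then
              ∏ i, ((moebius (d i) : ℝ) *
                Real.log ((((f i).eval (n : ℤ)).toNat : ℝ) / (d i : ℝ))) else 0)
        - (∑ d ∈ Fintype.piFinset (fun i => (((f i).eval (n : ℤ)).toNat).divisors),
            if (x : ℝ) / Real.log x ^ (2 * k + 2) < ∏ i, (d i : ℝ) then
              ∏ i, ((moebius (d i) : ℝ) *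
                Real.log ((((f i).eval (n : ℤ)).toNat : ℝ) / (d i : ℝ))) else 0)))
        =o[atTop] fun x : ℕ => (x : ℝ)) :
    (∀ (k : ℕ) (f : Fin k → ℤ[X]), IsBatemanHornSystem f →
      (fun x : ℕ => ∑ n ∈ Finset.Icc 1 x,
        ∑ d ∈ Fintype.piFinset (fun i => (((f i).eval (n : ℤ)).toNat).divisors),
          if (x : ℝ) / Real.log x ^ (2 * k + 2) < ∏ i, (d i : ℝ) then
            ∏ i, ((moebius (d i) : ℝ) *
              Real.log ((((f i).eval (n : ℤ)).toNat : ℝ) / (d i : ℝ))) else 0)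
        =o[atTop] fun x : ℕ => (x : ℝ))
    ↔ PolyMobiusTail := by
  constructor
  · -- from the natural log tail to the crux (`η = 3/4`)
    intro hLog k f hf
    rcases Nat.eq_zero_or_pos k with hk0 | hk
    · subst hk0
      exact polyMobiusTail_fin_zero f
    refine ⟨3 / 4, by norm_num, by norm_num, ?_⟩
    have e1 := hBridge k f hf (3 / 4) (by norm_num) (by norm_num)
    have e2 := hStrip k hk f hf (3 / 4) (by norm_num) (by norm_num)
    have e3 := hLog k f hf
    have e := ((e1.add e2).add e3).const_mul_left ((-1 : ℝ) ^ k)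
    refine e.congr' (Eventually.of_forall fun x => ?_) EventuallyEq.rfl
    have hk : ((-1 : ℝ) ^ k) * ((-1 : ℝ) ^ k) = 1 := by
      rw [← mul_pow]; norm_num
    beta_reduce
    rw [← Finset.sum_add_distrib, ← Finset.sum_add_distrib, Finset.mul_sum]
    refine Finset.sum_congr rfl fun n _ => ?_
    generalize (∑ d ∈ Fintype.piFinset (fun i => (((f i).eval (n : ℤ)).toNat).divisors),
        if (x : ℝ) ^ (1 - 3 / 4 : ℝ) < ∏ i, (d i : ℝ) then
          ∏ i, ((moebius (d i) : ℝ) * Real.log (d i)) else 0) = R at *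
    generalize (∑ d ∈ Fintype.piFinset (fun i => (((f i).eval (n : ℤ)).toNat).divisors),
        if (x : ℝ) ^ (1 - 3 / 4 : ℝ) < ∏ i, (d i : ℝ) then
          ∏ i, ((moebius (d i) : ℝ) *
            Real.log ((((f i).eval (n : ℤ)).toNat : ℝ) / (d i : ℝ))) else 0) = A at *
    generalize (∑ d ∈ Fintype.piFinset (fun i => (((f i).eval (n : ℤ)).toNat).divisors),
        if (x : ℝ) / Real.log x ^ (2 * k + 2) < ∏ i, (d i : ℝ) then
          ∏ i, ((moebius (d i) : ℝ) *
            Real.log ((((f i).eval (n : ℤ)).toNat : ℝ) / (d i : ℝ))) else 0) = B at *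
    linear_combination R * hk
  · -- from the crux (at every `η`, by `TypeIMainTerm`) to the natural log tail
    intro hCrux k f hf
    rcases Nat.eq_zero_or_pos k with hk0 | hk
    · subst hk0
      exact naturalLogTail_fin_zero f
    have hT := (polyMobiusTail_iff_forall_eta hMain).mp hCrux k f hf (3 / 4) (by norm_num) (by norm_num)
    have e1 := hBridge k f hf (3 / 4) (by norm_num) (by norm_num)
    have e2 := hStrip k hk f hf (3 / 4) (by norm_num) (by norm_num)
    have e := ((hT.const_mul_left ((-1 : ℝ) ^ k)).sub e1).sub e2
    refine e.congr' (Eventually.of_forall fun x => ?_) EventuallyEq.rfl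
    beta_reduce
    rw [Finset.mul_sum, ← Finset.sum_sub_distrib, ← Finset.sum_sub_distrib]
    refine Finset.sum_congr rfl fun n _ => ?_
    ring

end Summit.Parity.BatemanHorn.Theorems.PolyMobiusTail.NaturalForm
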